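import Summits.QuantumFields.YangMills.Theorems.BalabanUVNodesN09MeasurableAxialCritCfg
import Summits.QuantumFields.YangMills.Theorems.BalabanUVNodesN09GaugeFixingTermContinuousOnAdmissible
import Summits.QuantumFields.YangMills.Theorems.BalabanUVNodesN09SelectorContinuousOfThm1TwoRadii
import Summits.QuantumFields.YangMills.Theorems.BalabanUVNodesN09LocalSupportSetAnyCrit

/-!
# NODE N09 [B12] · THE AXIAL EDITION'S CLAUSES: a block-axial normal form of `T^{(k)}` that is CONTINUOUS ON THE FEDERBUSH-ADMISSIBLE SET, and the AXIAL critical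
# configuration `W ↦ ax(V^{(k),Sel}(W))` with EVERY letter clause road B displays — measurable, in the fibre, block-axial, (181)ˢᵒˡ-covariant, Prop-2 small, `ContinuousOn`

Cell `pub-ymgap` (YM-PLAN Track A), DAG node N09 [Balaban1987RG1] (= [I]); width seat `pub-ymgap-dag-n09-w5` g7, FILE 1; count-neutral helper keyed to K1⁹
`StabilityBRunRowsAtRecordR13SepCoPHV` = stmt-QuantumFields-27364 (`--kind proof --supports … --as helper`).  [B7] = [Balaban1985Averaging] (CMP 98), [B8] =
[Balaban1985RegularSpaces] (CMP 99), [B11] = [Balaban1985Variational] (CMP 102).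

WHY.  Print's (2.3) p. 265 reads the critical configuration «in the axial gauge»: `V^{(k)}(W) = M^k(U_{k+1}(W))` with `𝐆(V^{(k)}) = 0`, and (2.5) p. 266 starts at SECOND order in
`B′` precisely because of that.  The tree has the object in two halves: dag-n09-w2's MEASURABLE block-axial normal form `ax` (`…N09MeasurableAxialCritCfg`: the explicit fine
element `u_V(x) = U(Γ_{y(x),x})` off the centres, `1` on them) composed with dag-n09-w4's measurable rooted selection `critCfgSelOfRecord = M^k ∘ UkSel_{k+1}`; and road B's
letter-parametric engine (dag-n09-w3 `…N09LocalSupportSetAnyCrit`, dag-n09-w2's regularity towers), which asks of ANY letter `crit : GaugeField_{k+1} → GaugeField_k` three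
DISPLAYED clauses on the small-field domain: the fibre identity `M(crit W) = W`, [B7] Prop-2 smallness `PlaqSmall δ (crit W)`, and `ContinuousOn crit`.  For the AXIAL
letter the third clause was typed by nobody: `ax` is built from the AVERAGED contour variables `U(y,x)` of (0.11), whose Federbush mean (0.10) is a PARTIAL object — continuous
exactly on the admissible set (dag-n09-w1 `…N09GaugeFixingTermContinuousOnAdmissible.continuousOn_holTo_federbushSU`), which contains every `a`-small field once
`((d·L)²∕4)·a < δ_N` (`adm_stairHol_of_plaqSmall`).  THIS FILE closes the gap: ONE normal form `ax` that is fine-related, axial, measurable AND continuous on the admissible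
set (§1 generic, §2 record), and the axial letter `ax ∘ critCfgSelOfRecord` with all six clauses (§3), the selector's continuity first DISPLAYED, then discharged by
dag-n09-w1's two-radii theorem `continuousOn_critCfgSelOfRecord_of_thm1_of_reg8` ([B11] Thm 1 at `εbg` + (8) + numerics), and finally packaged as a LEVEL FAMILY
`crit : (j : ℕ) → GaugeField_{j+1} → GaugeField_j` on the small-field domains `domAltOfRecord ν K (j+1)`, `j < K` — the shape road B's towers quantify over.

WHAT IS PROVED (theorems only; 0 `def`, 0 `instance`, 0 `sorry`; axioms standard).
* §1 (generic topological gauge group, any contour system `cd`) `continuousOn_fineAxialElement_apply`, `continuousOn_gaugeAct_of_apply` (a field-dependent gauge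
  transformation acts continuously on a set where its values do), ★ `exists_measurable_continuousOn_axialNormalForm` (ONE `ax`: fine-related ∧ axial ∧ `Measurable ax` ∧
  `ContinuousOn ax A`, for contour variables measurable everywhere and continuous on `A`).
* §2 (record: `SU(N)`, def-B's `contourOfRecord`) `continuousOn_holTo_contourOfRecord_admissible`, ★ `exists_axialNormalForm_contourOfRecord_continuousOn_admissible`,
  `setOf_plaqSmall_subset_admissible`, `domAltOfRecord_subset_admissible`.
* §3 (the axial letter) ★★★ `exists_axialCritCfg` — for `k + 1 ≤ m + K`: `∃ crit`, (a) `Measurable crit` · (b) `M(crit W) = W` on `UkExists (k+1) ν.εreg` · (c)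
  `AxialGauge (contourOfRecord F N K k) (crit W)` for EVERY `W` · (d) `crit (W^v) = (crit W)^{v∘blockOf}` on `UkExists ∧ UniqueUkOrbit` · (e) `crit W` is FINE-RELATED to
  `V^{(k),Sel}(W)`, hence `PlaqSmall δ (V^{(k),Sel} W) → PlaqSmall δ (crit W)` for every `δ` · (f) `ContinuousOn crit D` for every `D` on which `V^{(k),Sel}` is continuous and
  `a`-small with `((d·L)²∕4)·a < δ_N`;  ★★★ `exists_axialCritCfg_clauses_of_continuousOn_sel` (road B's three clauses on `D ⊆ {UkExists (k+1) ν.εreg}` from numerics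
  `0 < εreg`, the (53)-pair at `εreg`, `2εreg ≤ δL²`, `((d·L)²∕4)·δ < δ_N`, selector continuity DISPLAYED);  ★★★ `exists_axialCritCfg_clauses_of_thm1_of_reg8` (selector
  continuity DISCHARGED: [B11] Thm 1 ×2 at `εbg` + (8)-membership on `D` + dag-n09-w1's loop-guard numerics);  ★★ `exists_axialCritCfg_family_domAlt_of_hsolν_of_hcritSel`
  (the LEVEL FAMILY on `domAltOfRecord ν K (j+1)`, `j < K`, from the Sel tower's own binders `hsolν` + `hcritSel`);  ★★★
  `exists_axialCritCfg_family_domAlt_of_thm1_εbg_of_reg8` (the same from the tower-shaped two-radii binders `h11 hreg8 : ∀ k ≤ K, ∀ V ∈ domAlt_k, …` + numerics only).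

HONEST SCOPE ∕ FRAMING.  Count-neutral kernel topology ∕ gauge algebra BY NAME over NODE 00's definitions (def-B `contourOfRecord`, K0c `critCfgSelOfRecord`, K0e `domAltOfRecord`),
dag-n09-w1's Federbush-admissibility and selector-continuity theorems, dag-n09-w2's axial files, dag-n09-w3's Prop-2 face and dag-n21-c's (53); [B11] Thm 1 enters ONLY as
displayed hypotheses (`hsol`, `h11`, `hreg8`); all numerics DISPLAYED, asserted of no record (at a witness with `εreg = 1` the Federbush letter fails — located, as for every
print-regime letter); NO record edition is made (adopting the axial letter for `critCfgOfRecord` ∕ `JInputs.Φ₀` is K0e ∕ def-T's call); NOTHING of Bałaban's analysis asserted;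
N09 NOT discharged; conjunct 1 (Lemma 4) ∕ FLAG №7 untouched; K0⁷ ∕ K1⁹ ∕ K3⁸ NOT closed; counts unmoved (typed 28∕28 · discharged 5∕28); one finite four-torus programme at
fixed `ε = L^{−K}` per run — R4 closes the conditional rung `BalabanLadder.UV` only; NOT ℝ⁴ ∕ infinite volume ∕ OS; the Yang–Mills mass gap (Clay) is NOT proved by any of this.
-/

noncomputable section

open Set Filter Topology MeasureTheory

namespace Summit.QuantumFields.YangMills.BalabanUVNodes.N09ContinuousAxialCritCfg

open Literature.MathematicalPhysics.QuantumFieldTheory.Balaban1983to89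
open Literature.MathematicalPhysics.QuantumFieldTheory.Balaban1983to89.Node00
open Literature.MathematicalPhysics.QuantumFieldTheory.Balaban1983to89.T4Continuum (T4Family)
open Literature.MathematicalPhysics.QuantumFieldTheory.Balaban1983to89.ExpMeanLog (deltaSU)
open Literature.MathematicalPhysics.QuantumFieldTheory.Balaban1983to89.FederbushMean
open Literature.MathematicalPhysics.QuantumFieldTheory.Balaban1983to89.BlockAveragingTwoLevel (stairHol offsetOf)
open B12RTGaugeInvariance254 (liftTransf)
open B12GaugeOrbits021 (plaqSmall_gaugeAct_iff')
open GaugeField (gaugeAct)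
open Summit.QuantumFields.YangMills.BalabanUVNodes.N09MeasurableAxialCritCfg (measurable_fineAxialElement_apply measurable_gaugeAct_of_apply
  measurable_holTo_contourOfRecord)
open Summit.QuantumFields.YangMills.BalabanUVNodes.N09AxialCovariance181 (ax_iter_sel_gaugeAct avg_ax_eq uniqueUkOrbit_gaugeAct_iff)
open Summit.QuantumFields.YangMills.BalabanUVNodes.N09LiftInvariance29AtRecord (gaugeAct_mem_bgReg ukExists_gaugeAct_iff)
open Summit.QuantumFields.YangMills.BalabanUVNodes.N09GaugeFixingTermContinuousOnAdmissible (continuousOn_holTo_federbushSU adm_stairHol_of_plaqSmall)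
open Summit.QuantumFields.YangMills.BalabanUVNodes.N09BackgroundRadiiTransfer (ukExists_of_le_of_Uk_mem)
open Summit.QuantumFields.YangMills.BalabanUVNodes.N09SelectorContinuousOfThm1TwoRadii (continuousOn_critCfgSelOfRecord_of_thm1_of_reg8)
open Summit.QuantumFields.YangMills.BalabanUVNodes.N09LocalSupportSetAnyCrit (hcritSel_of_ukExists)

/-! ## §1. Generic topological gauge group: the explicit fine axial-gauging element is continuous where the contour variables are; ONE normal form with four properties -/

section Generic

variable {P : Params} {j : ℕ} {G : Type*} [GaugeGroup G] [TopologicalSpace G] [ContinuousMul G] [ContinuousInv G]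

omit [ContinuousMul G] [ContinuousInv G] in
/-- The explicit fine axial-gauging element (`u_V(x) = 1` at a centre, `= V(Γ_{y(x),x})` otherwise) is CONTINUOUS in `V` on every set `A` on which the contour variables
`V ↦ V(Γ_{y,x})`, `x ∈ B(y)`, are. [cite: Balaban1985RegularSpaces, (1.15) p.78 (bookkeeping); Balaban1987RG1, (0.11) p.253] -/
theorem continuousOn_fineAxialElement_apply (cd : ContourData P j G) {A : Set (GaugeField P j G)}
    (hcd : ∀ (y : Site P (j + 1)), ∀ x ∈ block y, ContinuousOn (fun V : GaugeField P j G => cd.holTo V y x) A) (x : Site P j) :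
    ContinuousOn (fun V : GaugeField P j G => (if x = emb (blockOf x) then (1 : G) else cd.holTo V (blockOf x) x)) A := by
  by_cases hx : x = emb (blockOf x)
  · simp only [if_pos hx]
    exact continuousOn_const
  · simp only [if_neg hx]
    exact hcd (blockOf x) x (by simp [block])

/-- A FIELD-DEPENDENT gauge transformation acts continuously on a set where its values do: if `V ↦ u_V(x)` is continuous on `A` for every site, so is `V ↦ V^{u_V}`
(bondwise products and inverses in a topological group). [cite: Balaban1985Averaging, (8) p.19 (bookkeeping)] -/
theorem continuousOn_gaugeAct_of_apply {u : GaugeField P j G → GaugeTransf P j G} {A : Set (GaugeField P j G)}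
    (hu : ∀ x : Site P j, ContinuousOn (fun V => u V x) A) :
    ContinuousOn (fun V : GaugeField P j G => gaugeAct (u V) V) A := by
  refine continuousOn_pi.2 fun b => ?_
  have hb : ContinuousOn (fun V : GaugeField P j G => V b) A := (continuous_apply b).continuousOn
  exact ((hu b.src).mul hb).mul (hu b.tgt).inv

variable [MeasurableSpace G] [RegularGaugeGroup G]

/-- ★ **ONE BLOCK-AXIAL NORMAL FORM, FOUR PROPERTIES** (standing range `j + 1 ≤ m + K`): for a contour system whose contour variables are measurable and continuous on `A`,
the explicit map `ax V = V^{u_V}` is fine-related (`u_V = 1` at the centres), axial for every `V` (dag-n09-w2 FILE 5's element), MEASURABLE (dag-n09-w2 FILE 9) AND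
`ContinuousOn ax A`. [cite: Balaban1985RegularSpaces, (1.15) p.78; Balaban1987RG1, (2.3) p.265 and (0.11) p.253] -/
theorem exists_measurable_continuousOn_axialNormalForm (hj : j + 1 ≤ P.m + P.K) (cd : ContourData P j G)
    (hcdm : ∀ (y : Site P (j + 1)) (x : Site P j), Measurable fun V : GaugeField P j G => cd.holTo V y x)
    {A : Set (GaugeField P j G)} (hcdc : ∀ (y : Site P (j + 1)), ∀ x ∈ block y, ContinuousOn (fun V : GaugeField P j G => cd.holTo V y x) A) :
    ∃ ax : GaugeField P j G → GaugeField P j G,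
      (∀ V, ∃ u : GaugeTransf P j G, (∀ y : Site P (j + 1), u (emb y) = 1) ∧ ax V = gaugeAct u V) ∧ (∀ V, AxialGauge cd (ax V)) ∧
      Measurable ax ∧ ContinuousOn ax A := by
  classical
  refine ⟨fun V => gaugeAct (fun x => if x = emb (blockOf x) then (1 : G) else cd.holTo V (blockOf x) x) V, fun V => ⟨_, fun y => ?_, rfl⟩,
    fun V y x hxy hx => ?_, measurable_gaugeAct_of_apply fun x => measurable_fineAxialElement_apply cd hcdm x,
    continuousOn_gaugeAct_of_apply fun x => continuousOn_fineAxialElement_apply cd hcdc x⟩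
  · have h : emb y = emb (blockOf (emb y)) := by rw [Site.blockOf_emb hj y]
    show (if emb y = emb (blockOf (emb y)) then (1 : G) else cd.holTo V (blockOf (emb y)) (emb y)) = 1
    rw [if_pos h]
  · subst hxy
    have h : emb (blockOf x) = emb (blockOf (emb (blockOf x))) := by rw [Site.blockOf_emb hj (blockOf x)]
    rw [cd.covariant]
    show (if emb (blockOf x) = emb (blockOf (emb (blockOf x))) then (1 : G) else cd.holTo V (blockOf (emb (blockOf x))) (emb (blockOf x))) *
        cd.holTo V (blockOf x) x * (if x = emb (blockOf x) then (1 : G) else cd.holTo V (blockOf x) x)⁻¹ = 1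
    rw [if_pos h, if_neg hx, one_mul, mul_inv_cancel]

end Generic

/-! ## §2. The record: def-B's averaged contour variables are continuous on the Federbush-admissible set; ONE normal form of `T^{(k)}`, measurable and continuous there -/

section Record

variable {F : T4Family} {N : ℕ} [NeZero N]

/-- def-B's averaged contour variable of record `U(y,x)` ((0.11) at Federbush's mean (0.10)), `x ∈ B(y)`, is continuous on the ADMISSIBLE SET of step `k` (every staircase
family `{U(Γ^σ_{y′,x′})}_σ`, `x′ ∈ B(y′)`, `δ_N`-admissible) — dag-n09-w1's `continuousOn_holTo_federbushSU` restricted. [cite: Balaban1987RG1, (0.10)–(0.11) p.253] -/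
theorem continuousOn_holTo_contourOfRecord_admissible (K k : ℕ) (y : Site (F.P K) (k + 1)) {x : Site (F.P K) k} (hx : x ∈ block y) :
    ContinuousOn (fun U : GaugeField (F.P K) k (SU N) => (contourOfRecord F N K k).holTo U y x)
      {U : GaugeField (F.P K) k (SU N) | ∀ y : Site (F.P K) (k + 1), ∀ x ∈ block y,
        (federbushSU (n := Fin N)).Adm (stairHol U y (offsetOf y x))} :=
  (continuousOn_holTo_federbushSU y x).mono fun _ hU => hU y x hx

/-- ★ **A BLOCK-AXIAL NORMAL FORM OF `T^{(k)}` FOR def-B's CONTOUR SYSTEM, MEASURABLE AND CONTINUOUS ON THE ADMISSIBLE SET** (`k + 1 ≤ m + K`): one map `ax` with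
`ax V = V^u`, `u` fine, `ax V` axial for every `V`, `Measurable ax`, and `ContinuousOn ax {admissible}`.
[cite: Balaban1985RegularSpaces, (1.15) p.78; Balaban1987RG1, (0.11) p.253 and (2.3) p.265] -/
theorem exists_axialNormalForm_contourOfRecord_continuousOn_admissible {K k : ℕ} (hk : k + 1 ≤ (F.P K).m + (F.P K).K) :
    ∃ ax : GaugeField (F.P K) k (SU N) → GaugeField (F.P K) k (SU N),
      (∀ V, ∃ u : GaugeTransf (F.P K) k (SU N), (∀ y : Site (F.P K) (k + 1), u (emb y) = 1) ∧ ax V = gaugeAct u V) ∧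
      (∀ V, AxialGauge (contourOfRecord F N K k) (ax V)) ∧ Measurable ax ∧
      ContinuousOn ax {U : GaugeField (F.P K) k (SU N) | ∀ y : Site (F.P K) (k + 1), ∀ x ∈ block y,
        (federbushSU (n := Fin N)).Adm (stairHol U y (offsetOf y x))} :=
  exists_measurable_continuousOn_axialNormalForm hk (contourOfRecord F N K k) (measurable_holTo_contourOfRecord K k)
    fun y _ hx => continuousOn_holTo_contourOfRecord_admissible K k y hx

/-- **`a`-SMALL FIELDS ARE ADMISSIBLE** once `0 ≤ a` and `((d·L)²∕4)·a < δ_N` (dag-n09-w1's `adm_stairHol_of_plaqSmall`, as a set inclusion).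
[cite: Balaban1987RG1, (0.5) and (0.11) p.253] -/
theorem setOf_plaqSmall_subset_admissible {K k : ℕ} (hk : k + 1 ≤ (F.P K).m + (F.P K).K) {a : ℝ} (ha : 0 ≤ a)
    (hnum : ((((F.P K).d * (F.P K).L : ℕ) : ℝ)) ^ 2 / 4 * a < deltaFed (Fin N)) :
    {U : GaugeField (F.P K) k (SU N) | PlaqSmall a U} ⊆ {U : GaugeField (F.P K) k (SU N) | ∀ y : Site (F.P K) (k + 1), ∀ x ∈ block y,
        (federbushSU (n := Fin N)).Adm (stairHol U y (offsetOf y x))} :=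
  fun _ hU y _ hx => adm_stairHol_of_plaqSmall hk ha hU hnum y hx

/-- **THE SMALL-FIELD DOMAIN OF RECORD IS ADMISSIBLE** (`domAltOfRecord ν K k = {PlaqSmall ν.ε₀}`) once `0 ≤ ν.ε₀` and `((d·L)²∕4)·ν.ε₀ < δ_N`.
[cite: Balaban1987RG1, p.259 and (0.11) p.253] -/
theorem domAltOfRecord_subset_admissible (ν : Stage7Numerics) {K k : ℕ} (hk : k + 1 ≤ (F.P K).m + (F.P K).K) (hε : 0 ≤ ν.ε₀)
    (hnum : ((((F.P K).d * (F.P K).L : ℕ) : ℝ)) ^ 2 / 4 * ν.ε₀ < deltaFed (Fin N)) :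
    domAltOfRecord F N ν K k ⊆ {U : GaugeField (F.P K) k (SU N) | ∀ y : Site (F.P K) (k + 1), ∀ x ∈ block y,
        (federbushSU (n := Fin N)).Adm (stairHol U y (offsetOf y x))} :=
  fun U hU => setOf_plaqSmall_subset_admissible hk hε hnum ((mem_domAltOfRecord_iff F N ν K k U).1 hU)

end Record

/-! ## §3. The AXIAL critical configuration `W ↦ ax(V^{(k),Sel}(W))` with every letter clause road B displays -/

section AxialLetter

variable {F : T4Family} {N : ℕ} [NeZero N]

/-- ★★★ **THE AXIAL LETTER EXISTS WITH SIX CLAUSES** (torus `K`, level `k`, `k + 1 ≤ m + K`, numerics `ν`): a map `crit` on the level-`(k+1)` fields with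
(a) `Measurable crit`; (b) `M(crit W) = W` on the solvable set at radius `ν.εreg` ((2.3)–(2.4): in the fibre); (c) `AxialGauge (contourOfRecord F N K k) (crit W)` for EVERY `W`
(«𝐆(V^{(k)}) = 0»); (d) `crit (W^v) = (crit W)^{v∘blockOf}` on `UkExists ∧ UniqueUkOrbit` ((181)ˢᵒˡ); (e) `crit W = (V^{(k),Sel} W)^u` with `u` FINE — so every
plaquette-smallness of the Sel configuration transfers (`dist1` is conjugation invariant); (f) `ContinuousOn crit D` on every `D` where `V^{(k),Sel}` is continuous with
`a`-small values, `0 ≤ a`, `((d·L)²∕4)·a < δ_N` (the axial normal form is continuous on the admissible set, §2).  Witness: `ax ∘ critCfgSelOfRecord F N ν K k`.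
[cite: Balaban1987RG1, (2.1)–(2.4) pp.265–266 and (0.11) p.253; Balaban1985Variational, Thm 1 p.279 and (181) p.307; Balaban1985RegularSpaces, (1.15) p.78] -/
theorem exists_axialCritCfg (ν : Stage7Numerics) {K k : ℕ} (hk : k + 1 ≤ (F.P K).m + (F.P K).K) :
    ∃ crit : GaugeField (F.P K) (k + 1) (SU N) → GaugeField (F.P K) k (SU N),
      Measurable crit ∧
      (∀ W, UkExists F N K (k + 1) ν.εreg W → (avOfRecord F N K k).avg (crit W) = W) ∧
      (∀ W, AxialGauge (contourOfRecord F N K k) (crit W)) ∧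
      (∀ (v : GaugeTransf (F.P K) (k + 1) (SU N)) (W : GaugeField (F.P K) (k + 1) (SU N)),
        UkExists F N K (k + 1) ν.εreg W → UniqueUkOrbit F N K (k + 1) ν.εreg W → crit (gaugeAct v W) = gaugeAct (liftTransf v) (crit W)) ∧
      (∀ W, ∃ u : GaugeTransf (F.P K) k (SU N), (∀ y : Site (F.P K) (k + 1), u (emb y) = 1) ∧ crit W = gaugeAct u (critCfgSelOfRecord F N ν K k W)) ∧
      (∀ (δ : ℝ) (W : GaugeField (F.P K) (k + 1) (SU N)), PlaqSmall δ (critCfgSelOfRecord F N ν K k W) → PlaqSmall δ (crit W)) ∧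
      (∀ (D : Set (GaugeField (F.P K) (k + 1) (SU N))) (a : ℝ), 0 ≤ a →
        ((((F.P K).d * (F.P K).L : ℕ) : ℝ)) ^ 2 / 4 * a < deltaFed (Fin N) →
        (∀ W ∈ D, PlaqSmall a (critCfgSelOfRecord F N ν K k W)) →
        ContinuousOn (critCfgSelOfRecord F N ν K k) D → ContinuousOn crit D) := by
  obtain ⟨ax, hax₁, hax₂, haxm, haxc⟩ := exists_axialNormalForm_contourOfRecord_continuousOn_admissible (F := F) (N := N) hk
  refine ⟨fun W => ax (critCfgSelOfRecord F N ν K k W), haxm.comp (measurable_critCfgSelOfRecord ν K k), fun W hW => ?_, fun W => hax₂ _,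
    fun v W hW huW => ?_, fun W => hax₁ _, fun δ W hW => ?_, fun D a ha hnum hsm hsel => ?_⟩
  · rw [avg_ax_eq hk (avOfRecord F N K k) hax₁, avg_critCfgSelOfRecord hk hW]
  · show ax (Averaging.iter (avOfRecord F N K) k (UkSel F N K (k + 1) ν.εreg (gaugeAct v W))) =
      gaugeAct (liftTransf v) (ax (Averaging.iter (avOfRecord F N K) k (UkSel F N K (k + 1) ν.εreg W)))
    exact ax_iter_sel_gaugeAct (av := avOfRecord F N K) (reg := bgReg F N K (k + 1) ν.εreg) (sel := UkSel F N K (k + 1) ν.εreg) hk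
      (fun u U hU => gaugeAct_mem_bgReg u U hU) (contourOfRecord F N K k) hax₁ hax₂ (isBackground_UkSel hk hW)
      (isBackground_UkSel hk ((ukExists_gaugeAct_iff hk ν.εreg v W).2 hW)) ((uniqueUkOrbit_gaugeAct_iff hk ν.εreg v W).2 huW)
  · obtain ⟨u, -, hu⟩ := hax₁ (critCfgSelOfRecord F N ν K k W)
    show PlaqSmall δ (ax (critCfgSelOfRecord F N ν K k W))
    rw [hu]
    exact (plaqSmall_gaugeAct_iff' δ u _).2 hW
  · exact haxc.comp hsel fun W hW => setOf_plaqSmall_subset_admissible hk ha hnum (hsm W hW)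

/-- ★★★ **ROAD B's THREE LETTER CLAUSES FOR THE AXIAL LETTER, SELECTOR CONTINUITY DISPLAYED** (`k + 1 ≤ m + K`): on every set `D` of solvable level-`(k+1)` data
(`UkExists (k+1) ν.εreg`) on which `V^{(k),Sel}` is continuous, under numerics `0 < εreg`, the (53)-pair at `εreg`, `2εreg ≤ δL²` and the Federbush letter
`((d·L)²∕4)·δ < δ_N`: `∃ crit`, measurable ∧ in the fibre on the solvable set ∧ axial everywhere ∧ (181)ˢᵒˡ-covariant ∧ `∀ W ∈ D, PlaqSmall δ (crit W)` ∧ `ContinuousOn crit D`.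
Prop-2 smallness by dag-n09-w3's `hcritSel_of_ukExists` (dag-n21-c's (53) at NODE 00's averaging) and clause (e).
[cite: Balaban1987RG1, (2.3) p.265 and (2.9) p.266; Balaban1985Averaging, Prop. 2 (53) p.26; Balaban1985Variational, Thm 1 p.279] -/
theorem exists_axialCritCfg_clauses_of_continuousOn_sel (ν : Stage7Numerics) {K k : ℕ} (hk : k < K) {δ : ℝ} (hε : 0 < ν.εreg)
    (hε3 : (143 * (((((F.P K).d + 4 : ℕ) : ℝ)) ^ 2 / 4) ^ 2) * ν.εreg ≤ 1 / 3)
    (hε2 : 2 * ν.εreg ≤ 2 * deltaSU (Fin N) / ((((F.P K).d + 4) * (F.P K).L : ℕ) : ℝ) ^ 2) (hδ : 2 * ν.εreg ≤ δ * ((F.P K).L : ℝ) ^ 2)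
    (hnum : ((((F.P K).d * (F.P K).L : ℕ) : ℝ)) ^ 2 / 4 * δ < deltaFed (Fin N))
    {D : Set (GaugeField (F.P K) (k + 1) (SU N))} (hsol : ∀ W ∈ D, UkExists F N K (k + 1) ν.εreg W)
    (hsel : ContinuousOn (critCfgSelOfRecord F N ν K k) D) :
    ∃ crit : GaugeField (F.P K) (k + 1) (SU N) → GaugeField (F.P K) k (SU N),
      Measurable crit ∧
      (∀ W, UkExists F N K (k + 1) ν.εreg W → (avOfRecord F N K k).avg (crit W) = W) ∧
      (∀ W, AxialGauge (contourOfRecord F N K k) (crit W)) ∧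
      (∀ (v : GaugeTransf (F.P K) (k + 1) (SU N)) (W : GaugeField (F.P K) (k + 1) (SU N)),
        UkExists F N K (k + 1) ν.εreg W → UniqueUkOrbit F N K (k + 1) ν.εreg W → crit (gaugeAct v W) = gaugeAct (liftTransf v) (crit W)) ∧
      (∀ W ∈ D, PlaqSmall δ (crit W)) ∧ ContinuousOn crit D := by
  have hk1 : k + 1 ≤ (F.P K).m + (F.P K).K := by simp only [T4Family.P_K]; omega
  have hL0 : (0 : ℝ) < (F.P K).L := by exact_mod_cast (F.P K).L_pos
  have hδ0 : 0 ≤ δ := by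
    have h2 : 0 ≤ δ * ((F.P K).L : ℝ) ^ 2 := le_trans (by positivity) hδ
    exact nonneg_of_mul_nonneg_left h2 (by positivity)
  have hsm : ∀ W ∈ D, PlaqSmall δ (critCfgSelOfRecord F N ν K k W) := fun W hW => hcritSel_of_ukExists ν hk hε hε3 hε2 hδ (hsol W hW)
  obtain ⟨crit, ha, hb, hc, hd, -, he, hf⟩ := exists_axialCritCfg (F := F) (N := N) ν hk1
  exact ⟨crit, ha, hb, hc, hd, fun W hW => he δ W (hsm W hW), hf D δ hδ0 hnum hsm hsel⟩

/-- ★★★ **… SELECTOR CONTINUITY DISCHARGED BY THE TWO-RADII BINDERS** (dag-n09-w1 g6 `continuousOn_critCfgSelOfRecord_of_thm1_of_reg8`): on every set `D` of level-`(k+1)`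
data carrying [B11] Thm 1 ×2 at the background radius `εbg` (`h11`) and the (8)-membership `Uk … εbg W ∈ bgReg … ν.εreg` (`hreg8`), with `ν.εreg < εbg`, `ν.εreg < α₀`,
`α₀` admissible as in (53) plus dag-n09-w1's two loop-guard conditions, `0 < εreg`, the (53)-pair at `εreg`, `2εreg ≤ δL²`, `((d·L)²∕4)·δ < δ_N`, `k < K`: the axial letter with
all six clauses, the last two ON `D`.  Solvability at `εreg` on `D` is dag-n09-w1's `ukExists_of_le_of_Uk_mem` (no extra binder).
[cite: Balaban1987RG1, (2.3) p.265; Balaban1985Variational, Thm 1 (6), (8) p.279 and (181) p.307; Balaban1985Averaging, Prop. 2 (53) p.26] -/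
theorem exists_axialCritCfg_clauses_of_thm1_of_reg8 (ν : Stage7Numerics) {K k : ℕ} (hk : k < K) {εbg α₀ δ : ℝ} (hlt : ν.εreg < εbg) (he : ν.εreg < α₀)
    (hα : 0 < α₀) (hα3 : (143 * (((((F.P K).d + 4 : ℕ) : ℝ)) ^ 2 / 4) ^ 2) * α₀ ≤ 1 / 3)
    (hα2 : 2 * α₀ ≤ 2 * deltaSU (Fin N) / ((((F.P K).d + 4) * (F.P K).L : ℕ) : ℝ) ^ 2)
    (hα24 : ((((F.P K).d + 2) * (F.P K).L : ℕ) : ℝ) ^ 2 / 4 * (2 * α₀) ≤ 1 / 24)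
    (hαL : 157 * (((((F.P K).d + 2) * (F.P K).L : ℕ) : ℝ) ^ 2 / 4 * (2 * α₀)) < (((F.P K).L : ℝ) ^ ((F.P K).d - 1))⁻¹)
    (hε : 0 < ν.εreg) (hε3 : (143 * (((((F.P K).d + 4 : ℕ) : ℝ)) ^ 2 / 4) ^ 2) * ν.εreg ≤ 1 / 3)
    (hε2 : 2 * ν.εreg ≤ 2 * deltaSU (Fin N) / ((((F.P K).d + 4) * (F.P K).L : ℕ) : ℝ) ^ 2) (hδ : 2 * ν.εreg ≤ δ * ((F.P K).L : ℝ) ^ 2)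
    (hnum : ((((F.P K).d * (F.P K).L : ℕ) : ℝ)) ^ 2 / 4 * δ < deltaFed (Fin N))
    {D : Set (GaugeField (F.P K) (k + 1) (SU N))}
    (h11 : ∀ W ∈ D, UkExists F N K (k + 1) εbg W ∧ UniqueUkOrbit F N K (k + 1) εbg W)
    (hreg8 : ∀ W ∈ D, Uk F N K (k + 1) εbg W ∈ bgReg F N K (k + 1) ν.εreg) :
    ∃ crit : GaugeField (F.P K) (k + 1) (SU N) → GaugeField (F.P K) k (SU N),
      Measurable crit ∧
      (∀ W, UkExists F N K (k + 1) ν.εreg W → (avOfRecord F N K k).avg (crit W) = W) ∧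
      (∀ W, AxialGauge (contourOfRecord F N K k) (crit W)) ∧
      (∀ (v : GaugeTransf (F.P K) (k + 1) (SU N)) (W : GaugeField (F.P K) (k + 1) (SU N)),
        UkExists F N K (k + 1) ν.εreg W → UniqueUkOrbit F N K (k + 1) ν.εreg W → crit (gaugeAct v W) = gaugeAct (liftTransf v) (crit W)) ∧
      (∀ W ∈ D, PlaqSmall δ (crit W)) ∧ ContinuousOn crit D := by
  have hk1 : k + 1 ≤ (F.P K).m + (F.P K).K := by simp only [T4Family.P_K]; omega
  exact exists_axialCritCfg_clauses_of_continuousOn_sel ν hk hε hε3 hε2 hδ hnum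
    (fun W hW => ukExists_of_le_of_Uk_mem hlt.le (h11 W hW).1 (hreg8 W hW))
    (continuousOn_critCfgSelOfRecord_of_thm1_of_reg8 ν K k hlt he hα hα3 hα2 hα24 hαL hk1 h11 hreg8)

/-- ★★ **THE AXIAL LETTER AS A LEVEL FAMILY FROM THE Sel TOWER's OWN BINDERS** (`hsolν` + the Sel letter's displayed continuity `hcritSel`): whoever holds road B's
inputs for the Sel letter — `hsolν : ∀ j < K, ∀ W ∈ domAlt_{j+1}, UkExists (j+1) ν.εreg W` and `hcritSel : ∀ j < K, ContinuousOn (V^{(j),Sel}) domAlt_{j+1}` — holds them for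
the AXIAL letter too (road B's per-step shapes `hfib`, `hcritδ`, `hcrit` at `D := domAlt_{j+1}` verbatim), with axiality and (181)ˢᵒˡ-covariance added: numerics `0 < εreg`,
the (53)-pair at `εreg`, `2εreg ≤ δL²`, `((d·L)²∕4)·δ < δ_N`.
[cite: Balaban1987RG1, (2.3) p.265 and p.259; Balaban1985Averaging, Prop. 2 (53) p.26; Balaban1985Variational, (181) p.307] -/
theorem exists_axialCritCfg_family_domAlt_of_hsolν_of_hcritSel (ν : Stage7Numerics) (K : ℕ) {δ : ℝ} (hε : 0 < ν.εreg)
    (hε3 : (143 * (((((F.P K).d + 4 : ℕ) : ℝ)) ^ 2 / 4) ^ 2) * ν.εreg ≤ 1 / 3)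
    (hε2 : 2 * ν.εreg ≤ 2 * deltaSU (Fin N) / ((((F.P K).d + 4) * (F.P K).L : ℕ) : ℝ) ^ 2) (hδ : 2 * ν.εreg ≤ δ * ((F.P K).L : ℝ) ^ 2)
    (hnum : ((((F.P K).d * (F.P K).L : ℕ) : ℝ)) ^ 2 / 4 * δ < deltaFed (Fin N))
    (hsolν : ∀ j < K, ∀ W ∈ domAltOfRecord F N ν K (j + 1), UkExists F N K (j + 1) ν.εreg W)
    (hcritSel : ∀ j < K, ContinuousOn (critCfgSelOfRecord F N ν K j) (domAltOfRecord F N ν K (j + 1))) :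
    ∃ crit : (j : ℕ) → GaugeField (F.P K) (j + 1) (SU N) → GaugeField (F.P K) j (SU N), ∀ j, j < K →
      Measurable (crit j) ∧
      (∀ W ∈ domAltOfRecord F N ν K (j + 1), (avOfRecord F N K j).avg (crit j W) = W) ∧
      (∀ W, AxialGauge (contourOfRecord F N K j) (crit j W)) ∧
      (∀ (v : GaugeTransf (F.P K) (j + 1) (SU N)) (W : GaugeField (F.P K) (j + 1) (SU N)),
        UkExists F N K (j + 1) ν.εreg W → UniqueUkOrbit F N K (j + 1) ν.εreg W → crit j (gaugeAct v W) = gaugeAct (liftTransf v) (crit j W)) ∧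
      (∀ W ∈ domAltOfRecord F N ν K (j + 1), PlaqSmall δ (crit j W)) ∧ ContinuousOn (crit j) (domAltOfRecord F N ν K (j + 1)) := by
  have H : ∀ j : ℕ, ∃ c : GaugeField (F.P K) (j + 1) (SU N) → GaugeField (F.P K) j (SU N), j < K →
      Measurable c ∧
      (∀ W ∈ domAltOfRecord F N ν K (j + 1), (avOfRecord F N K j).avg (c W) = W) ∧
      (∀ W, AxialGauge (contourOfRecord F N K j) (c W)) ∧
      (∀ (v : GaugeTransf (F.P K) (j + 1) (SU N)) (W : GaugeField (F.P K) (j + 1) (SU N)),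
        UkExists F N K (j + 1) ν.εreg W → UniqueUkOrbit F N K (j + 1) ν.εreg W → c (gaugeAct v W) = gaugeAct (liftTransf v) (c W)) ∧
      (∀ W ∈ domAltOfRecord F N ν K (j + 1), PlaqSmall δ (c W)) ∧ ContinuousOn c (domAltOfRecord F N ν K (j + 1)) := by
    intro j
    by_cases hj : j < K
    · obtain ⟨c, ha, hb, hc⟩ := exists_axialCritCfg_clauses_of_continuousOn_sel ν hj hε hε3 hε2 hδ hnum (hsolν j hj) (hcritSel j hj)
      exact ⟨c, fun _ => ⟨ha, fun W hW => hb W (hsolν j hj W hW), hc⟩⟩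
    · exact ⟨critCfgSelOfRecord F N ν K j, fun h => absurd h hj⟩
  choose crit hcrit using H
  exact ⟨crit, hcrit⟩

/-- ★★★ **THE AXIAL LETTER AS A LEVEL FAMILY ON THE SMALL-FIELD DOMAINS OF RECORD** — the shape road B's towers quantify over: from the tower-shaped two-radii binders
`h11 hreg8 : ∀ k ≤ K, ∀ V ∈ domAltOfRecord ν K k, …` (dag-n09-w1 g2's displayed shapes) and the numerics above, a family `crit : (j : ℕ) → GaugeField_{j+1} → GaugeField_j`
with, for every `j < K`: measurable · in the fibre ON `domAltOfRecord ν K (j+1)` (road B's `hfib` verbatim) · axial for `contourOfRecord F N K j` everywhere · (181)ˢᵒˡ-covariant ·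
`∀ W ∈ domAltOfRecord ν K (j+1), PlaqSmall δ (crit j W)` · `ContinuousOn (crit j) (domAltOfRecord ν K (j+1))`.  (Above `K` the family is junk — the Sel letter.)
[cite: Balaban1987RG1, (2.3) p.265 and p.259; Balaban1985Variational, Thm 1 (6), (8) p.279 and (181) p.307; Balaban1985Averaging, Prop. 2 (53) p.26] -/
theorem exists_axialCritCfg_family_domAlt_of_thm1_εbg_of_reg8 (ν : Stage7Numerics) (εbg : ℝ) (K : ℕ) {α₀ δ : ℝ} (hlt : ν.εreg < εbg) (he : ν.εreg < α₀)
    (hα : 0 < α₀) (hα3 : (143 * (((((F.P K).d + 4 : ℕ) : ℝ)) ^ 2 / 4) ^ 2) * α₀ ≤ 1 / 3)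
    (hα2 : 2 * α₀ ≤ 2 * deltaSU (Fin N) / ((((F.P K).d + 4) * (F.P K).L : ℕ) : ℝ) ^ 2)
    (hα24 : ((((F.P K).d + 2) * (F.P K).L : ℕ) : ℝ) ^ 2 / 4 * (2 * α₀) ≤ 1 / 24)
    (hαL : 157 * (((((F.P K).d + 2) * (F.P K).L : ℕ) : ℝ) ^ 2 / 4 * (2 * α₀)) < (((F.P K).L : ℝ) ^ ((F.P K).d - 1))⁻¹)
    (hε : 0 < ν.εreg) (hε3 : (143 * (((((F.P K).d + 4 : ℕ) : ℝ)) ^ 2 / 4) ^ 2) * ν.εreg ≤ 1 / 3)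
    (hε2 : 2 * ν.εreg ≤ 2 * deltaSU (Fin N) / ((((F.P K).d + 4) * (F.P K).L : ℕ) : ℝ) ^ 2) (hδ : 2 * ν.εreg ≤ δ * ((F.P K).L : ℝ) ^ 2)
    (hnum : ((((F.P K).d * (F.P K).L : ℕ) : ℝ)) ^ 2 / 4 * δ < deltaFed (Fin N))
    (h11 : ∀ k, k ≤ K → ∀ V ∈ domAltOfRecord F N ν K k, UkExists F N K k εbg V ∧ UniqueUkOrbit F N K k εbg V)
    (hreg8 : ∀ k, k ≤ K → ∀ V ∈ domAltOfRecord F N ν K k, Uk F N K k εbg V ∈ bgReg F N K k ν.εreg) :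
    ∃ crit : (j : ℕ) → GaugeField (F.P K) (j + 1) (SU N) → GaugeField (F.P K) j (SU N), ∀ j, j < K →
      Measurable (crit j) ∧
      (∀ W ∈ domAltOfRecord F N ν K (j + 1), (avOfRecord F N K j).avg (crit j W) = W) ∧
      (∀ W, AxialGauge (contourOfRecord F N K j) (crit j W)) ∧
      (∀ (v : GaugeTransf (F.P K) (j + 1) (SU N)) (W : GaugeField (F.P K) (j + 1) (SU N)),
        UkExists F N K (j + 1) ν.εreg W → UniqueUkOrbit F N K (j + 1) ν.εreg W → crit j (gaugeAct v W) = gaugeAct (liftTransf v) (crit j W)) ∧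
      (∀ W ∈ domAltOfRecord F N ν K (j + 1), PlaqSmall δ (crit j W)) ∧ ContinuousOn (crit j) (domAltOfRecord F N ν K (j + 1)) := by
  have H : ∀ j : ℕ, ∃ c : GaugeField (F.P K) (j + 1) (SU N) → GaugeField (F.P K) j (SU N), j < K →
      Measurable c ∧
      (∀ W ∈ domAltOfRecord F N ν K (j + 1), (avOfRecord F N K j).avg (c W) = W) ∧
      (∀ W, AxialGauge (contourOfRecord F N K j) (c W)) ∧
      (∀ (v : GaugeTransf (F.P K) (j + 1) (SU N)) (W : GaugeField (F.P K) (j + 1) (SU N)),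
        UkExists F N K (j + 1) ν.εreg W → UniqueUkOrbit F N K (j + 1) ν.εreg W → c (gaugeAct v W) = gaugeAct (liftTransf v) (c W)) ∧
      (∀ W ∈ domAltOfRecord F N ν K (j + 1), PlaqSmall δ (c W)) ∧ ContinuousOn c (domAltOfRecord F N ν K (j + 1)) := by
    intro j
    by_cases hj : j < K
    · obtain ⟨c, ha, hb, hc⟩ := exists_axialCritCfg_clauses_of_thm1_of_reg8 ν hj hlt he hα hα3 hα2 hα24 hαL hε hε3 hε2 hδ hnum
        (h11 (j + 1) hj) (hreg8 (j + 1) hj)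
      exact ⟨c, fun _ => ⟨ha, fun W hW => hb W (ukExists_of_le_of_Uk_mem hlt.le (h11 (j + 1) hj W hW).1 (hreg8 (j + 1) hj W hW)), hc⟩⟩
    · exact ⟨critCfgSelOfRecord F N ν K j, fun h => absurd h hj⟩
  choose crit hcrit using H
  exact ⟨crit, hcrit⟩

end AxialLetter

end Summit.QuantumFields.YangMills.BalabanUVNodes.N09ContinuousAxialCritCfg
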